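import Summits.CriticalPhenomena.PercolationContinuityZ3.Theorems.PercNearOneGluingNoHeavyConstsMDLXJoint
import Summits.CriticalPhenomena.PercolationContinuityZ3.Theorems.PercNearOneGluingNoHeavyConstsChainRuleBernstein
import Literature.Probability.Percolation.LonePortSum
import HarnessLib
import HarnessLib.Audit.Tags

/-!
# CONJECTURE "three-copy (Bernstein) positivity of the MDL(X)′ margin" (MDLX-BERN) and the REDUCTION
# MDLX-BERN ⟹ `Consts.MDLXJoint` (PAPER-2 track (ii): constants of the CSH family)

builds on p205010 (kernel theorem, internal audit signed; external expert review pending).  Support file (`--supports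
stmt-CriticalPhenomena-4575`), seat `prim-consts-2` (gen 9); rows A6/A11 of `run/shared/lean/prim/consts/CONSTANTS.md`; memo
`run/shared/lean/prim/consts/FROM-prim-consts-2-g9-MDLXJOINT.md`.  One `Prop` definition (an OPEN finite signed-sum statement, tagged
`@[conjecture]`), two theorems; no sorries; standard axioms.

`Consts.MDLXJoint` (the covariance transfer MDL(X) with the jointly-conditioned observer constant
`p' = P(y ↔ z | y ↮ {s}∪X, s ↮ X)`; the surviving sharpening conjecture of rows A6/A11 after the refutation of the single-edge chain rule,
`Consts.not_singleEdgeChainRule`) reads, denominator-free, `μ(𝒜∩D∩W)·[μ(D) ∫_{D∩Y} F − (∫_D F) μ(D∩Y)] ≤ μ(𝒜∩D)·[μ(D) ∫_{D∩Z} F − (∫_D F) μ(D∩Z)]`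
with `D = {s ↮ X}`, `𝒜 = {y ↮ {s}∪X}`, `W = {y ↔ z}`, `Z = {s ↔ z}`, `Y = {s ↔ y}`, `F` monotone in the edge cluster `C_s`.
Each factor is an atom sum `Σ_η W(η)·(…)` of the product measure (`LonePortSum.measureReal_eq_sum`, `LonePortSum.setIntegral_eq_sum`),
so the margin `RHS − LHS` is a sum over THREE INDEPENDENT COPIES `η = (η₀, η₁, η₂)` (`Consts.mdlxJoint_margin_eq_sum_copies`):

  `RHS − LHS = Σ_η W(η₀)W(η₁)W(η₂) · Φ_F(η)`,
  `Φ_F(η) = 1_{𝒜∩D}(η₀) 1_D(η₁) 1_D(η₂) · (F(C_s η₂) − F(C_s η₁)) · (1_Z(η₂) − 1_W(η₀) 1_Y(η₂))`,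

and `W(η₀)W(η₁)W(η₂) = ∏_e w_e^{k_e}(1−w_e)^{3−k_e}` depends only on the PROFILE `k_e = #{c : e ∈ η_c}` (`Consts.prod_atomWeight_eq_profile`).
* `Consts.MDLXJointBernstein` — **CONJECTURE (OPEN)** MDLX-BERN: for every profile `k` and every monotone `F` the fibre sum
  `B_F(k) = Σ_{η with profile k} Φ_F(η)` is `≥ 0`; equivalently (by `F ↦` up-set indicators) for every up-set `U` of edge clusters of `s`,
  among the copy-triples of profile `k` with `η₀ ∈ 𝒜∩D`, `η₁, η₂ ∈ D` and `C_s(η₂) ∈ U`: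
  `#{z ∈ C_s(η₂) ∖ C_s(η₁)} − #{z ∈ C_s(η₁) ∖ C_s(η₂)} ≥ #{y ↔ z in η₀, y ∈ C_s(η₂) ∖ C_s(η₁)} − #{y ↔ z in η₀, y ∈ C_s(η₁) ∖ C_s(η₂)}`.
  EVIDENCE (exact integer arithmetic, this seat; engines `work/explore/mbern.py` — pure enumeration, min over ALL up-sets by exact max-flow — and
  kit jobs j150642/j150644, `work/jobs/adv5` — FFT profile tables + closure): ALL placements `(s,y,z,X={x})` on ALL connected graphs with `n = 4` and with
  `n = 6, m ≤ 8` (20 196 placements, 2.7·10⁷ (profile, up-set) minimisations), the 5-vertex graphs C₅, house, bull, C₅+chord (all placements), and the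
  `n = 7` chain-rule witness graph gid 538 at the witness placements: no negative fibre sum (memo §5).  The analogous three-copy positivity for the chain
  rule (`Consts.ChainRuleBernstein`) FAILS at `n = 7` (`Consts.not_chainRuleBernstein`), so the exhaustive `n = 7` tables are the test that matters (census ask, memo §7).
* `Consts.mdlxJoint_of_bernstein` — **THEOREM (reduction)**: `MDLXJointBernstein → MDLXJoint` (the margin is the nonnegative combination
  `Σ_k (∏_e w^{k_e}(1−w)^{3−k_e}) · B_F(k)`).
Why it matters: a lattice proof (Harris / Ahlswede–Daykin steps on the edge lattice, as in van den Berg–Häggström–Kahn's proof of their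
Thm 1.1) of `Consts.MDLXJoint` would give MDLX-BERN (memo FROM-prim-consts-2-g8-STAR-PEEL.md §1(ii)); MDLX-BERN surviving where BERN failed
is the first structural evidence that such a proof of MDL(X)′ can exist.
[cite: VandenbergHaggstromKahn2005, Thm. 1.1 (pp. 3–5) and its proof (Harris + four functions theorem)] [cite: Grimmett1999, §1.3 p. 10]
-/

noncomputable section

namespace Summit.CriticalPhenomena.PercolationContinuityZ3.Theorems

open MeasureTheory Set Literature.Probability.LatticeModels Literature.Probability.Percolation
open scoped Classical

namespace Consts

/-- **CONJECTURE MDLX-BERN — three-copy positivity of the MDL(X)′ margin (OPEN).**  For a finite graph on `Fin n`, owner `s`,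
markers `y, z`, avoided set `X`, a profile `k : Sym2 (Fin n) → ℕ` and a monotone functional `F` of edge sets: summing over the
triples `η = (η 0, η 1, η 2)` of edge configurations in which every pair `e` is open in exactly `k e` of the three copies, the signed sum of
`1{η 0 ∈ 𝒜∩D} · 1{η 1 ∈ D} · 1{η 2 ∈ D} · (F(C_s(η 2)) − F(C_s(η 1))) · (1{s ↔ z in η 2} − 1{y ↔ z in η 0} · 1{s ↔ y in η 2})`
is nonnegative (`D = {s ↮ X}`, `𝒜 = {y ↮ {s} ∪ X}`).  These fibre sums are the coefficients of the `Consts.MDLXJoint` margin in the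
trinomial Bernstein basis of the edge weights (`Consts.mdlxJoint_margin_eq_sum_copies`), so the conjecture implies `Consts.MDLXJoint`
(`Consts.mdlxJoint_of_bernstein`).  Evidence: exact, all placements on all connected graphs with `n = 4` and `n = 6, m ≤ 8` (and sampled `n = 5, 7`), min over all
up-sets: no negative fibre sum (memo FROM-prim-consts-2-g9-MDLXJOINT.md §5); exhaustive `n = 7` open (where `Consts.ChainRuleBernstein` fails).
[cite: VandenbergHaggstromKahn2005, Thm. 1.1 (pp. 3–5)] [status: open] -/
@[conjecture] def MDLXJointBernstein : Prop :=
  ∀ (n : ℕ) (s y z : Fin n) (X : Set (Fin n)) (k : Sym2 (Fin n) → ℕ) (F : Set (Sym2 (Fin n)) → ℝ), Monotone F →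
    0 ≤ ∑ η ∈ (Finset.univ : Finset (Fin 3 → BondConfig (Fin n))).filter
          (fun η => (fun e => ∑ c : Fin 3, if e ∈ η c then (1 : ℕ) else 0) = k),
        (if (∀ x ∈ insert s X, ¬ (openGraph (η 0)).Reachable y x) ∧ (∀ x ∈ X, ¬ (openGraph (η 0)).Reachable s x)
            then (1 : ℝ) else 0) *
          (if ∀ x ∈ X, ¬ (openGraph (η 1)).Reachable s x then (1 : ℝ) else 0) *
          (if ∀ x ∈ X, ¬ (openGraph (η 2)).Reachable s x then (1 : ℝ) else 0) *
          (F (openEdgeCluster (η 2) s) - F (openEdgeCluster (η 1) s)) *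
          ((if (openGraph (η 2)).Reachable s z then (1 : ℝ) else 0) -
            (if (openGraph (η 0)).Reachable y z then (1 : ℝ) else 0) * (if (openGraph (η 2)).Reachable s y then (1 : ℝ) else 0))

variable {V : Type*} [Fintype V]

open LonePortSum BHK2006 DecisionTree in
/-- **Product of three atom sums as one sum over copy-triples**: `(Σ_ω W(ω)f(ω))(Σ_ω W(ω)g(ω))(Σ_ω W(ω)h(ω)) =
Σ_{η : Fin 3 → configurations} (∏_c W(η c)) · f(η 0) g(η 1) h(η 2)`. [folklore] -/
theorem sum_weight_mul_three (w : Sym2 V → unitInterval) (f g h : BondConfig V → ℝ) :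
    (∑ ω, weight (fun e => (w e : ℝ)) ω * f ω) * (∑ ω, weight (fun e => (w e : ℝ)) ω * g ω) *
        (∑ ω, weight (fun e => (w e : ℝ)) ω * h ω) =
      ∑ η : Fin 3 → BondConfig V, (∏ c, weight (fun e => (w e : ℝ)) (η c)) * (f (η 0) * g (η 1) * h (η 2)) := by
  classical
  set u : Fin 3 → BondConfig V → ℝ := ![f, g, h] with hu
  have h1 : (∑ ω, weight (fun e => (w e : ℝ)) ω * f ω) * (∑ ω, weight (fun e => (w e : ℝ)) ω * g ω) *
        (∑ ω, weight (fun e => (w e : ℝ)) ω * h ω) =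
      ∏ c : Fin 3, ∑ ω, weight (fun e => (w e : ℝ)) ω * u c ω := by
    rw [Fin.prod_univ_three]
    simp [hu]
  rw [h1, Fintype.prod_sum]
  refine Finset.sum_congr rfl fun η _ => ?_
  rw [Fin.prod_univ_three, Fin.prod_univ_three]
  simp only [hu, Matrix.cons_val_zero, Matrix.cons_val_one, Matrix.cons_val]
  ring

open LonePortSum BHK2006 DecisionTree in
/-- The algebra of the three-copy expansion: with atom weights `W` and arbitrary `a, b, d, z, v, f : configurations → ℝ`,
`(ΣWa)[(ΣWd)(ΣW f d z) − (ΣW f d)(ΣW d z)] − (ΣW a b)[(ΣWd)(ΣW f d v) − (ΣW f d)(ΣW d v)]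
 = Σ_η (∏_c W(η c)) · a(η 0) d(η 1) d(η 2) (f(η 2) − f(η 1)) (z(η 2) − b(η 0) v(η 2))`. [folklore] -/
theorem mdlx_threeCopy_algebra (w : Sym2 V → unitInterval) (a b d z v f : BondConfig V → ℝ) :
    (∑ ω, weight (fun e => (w e : ℝ)) ω * a ω) *
        ((∑ ω, weight (fun e => (w e : ℝ)) ω * d ω) * (∑ ω, weight (fun e => (w e : ℝ)) ω * (f ω * (d ω * z ω))) -
          (∑ ω, weight (fun e => (w e : ℝ)) ω * (f ω * d ω)) * (∑ ω, weight (fun e => (w e : ℝ)) ω * (d ω * z ω))) -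
      (∑ ω, weight (fun e => (w e : ℝ)) ω * (a ω * b ω)) *
        ((∑ ω, weight (fun e => (w e : ℝ)) ω * d ω) * (∑ ω, weight (fun e => (w e : ℝ)) ω * (f ω * (d ω * v ω))) -
          (∑ ω, weight (fun e => (w e : ℝ)) ω * (f ω * d ω)) * (∑ ω, weight (fun e => (w e : ℝ)) ω * (d ω * v ω))) =
      ∑ η : Fin 3 → BondConfig V, (∏ c, weight (fun e => (w e : ℝ)) (η c)) *
        (a (η 0) * d (η 1) * d (η 2) * (f (η 2) - f (η 1)) * (z (η 2) - b (η 0) * v (η 2))) := by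
  classical
  set Wt : BondConfig V → ℝ := weight (fun e => (w e : ℝ)) with hWt
  have h : (∑ ω, Wt ω * a ω) *
        ((∑ ω, Wt ω * d ω) * (∑ ω, Wt ω * (f ω * (d ω * z ω))) -
          (∑ ω, Wt ω * (f ω * d ω)) * (∑ ω, Wt ω * (d ω * z ω))) -
      (∑ ω, Wt ω * (a ω * b ω)) *
        ((∑ ω, Wt ω * d ω) * (∑ ω, Wt ω * (f ω * (d ω * v ω))) -
          (∑ ω, Wt ω * (f ω * d ω)) * (∑ ω, Wt ω * (d ω * v ω))) =
      (∑ ω, Wt ω * a ω) * (∑ ω, Wt ω * d ω) * (∑ ω, Wt ω * (f ω * (d ω * z ω))) -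
        (∑ ω, Wt ω * a ω) * (∑ ω, Wt ω * (f ω * d ω)) * (∑ ω, Wt ω * (d ω * z ω)) -
        (∑ ω, Wt ω * (a ω * b ω)) * (∑ ω, Wt ω * d ω) * (∑ ω, Wt ω * (f ω * (d ω * v ω))) +
        (∑ ω, Wt ω * (a ω * b ω)) * (∑ ω, Wt ω * (f ω * d ω)) * (∑ ω, Wt ω * (d ω * v ω)) := by ring
  rw [h, hWt, sum_weight_mul_three, sum_weight_mul_three, sum_weight_mul_three, sum_weight_mul_three,
    ← Finset.sum_sub_distrib, ← Finset.sum_sub_distrib, ← Finset.sum_add_distrib]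
  refine Finset.sum_congr rfl fun η _ => ?_
  ring

open LonePortSum BHK2006 DecisionTree in
/-- **The MDL(X)′ margin over three copies.**  With `μ = prodBernoulli w`, `D = {s ↮ X}`, `𝒜 = {y ↮ {s}∪X}`, `W = {y ↔ z}`,
`Z = {s ↔ z}`, `Y = {s ↔ y}` and the real indicators `1_E = DecisionTree.ind E`:
`μ(𝒜∩D)·[μ(D)∫_{D∩Z}F − (∫_D F)μ(D∩Z)] − μ(𝒜∩D∩W)·[μ(D)∫_{D∩Y}F − (∫_D F)μ(D∩Y)]
 = Σ_{η : Fin 3 → configurations} (∏_c W(η c)) · 1_{𝒜∩D}(η 0) 1_D(η 1) 1_D(η 2) (F(C_s η 2) − F(C_s η 1)) (1_Z(η 2) − 1_W(η 0) 1_Y(η 2))`.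
[folklore] -/
theorem mdlxJoint_margin_eq_sum_copies (w : Sym2 V → unitInterval) (s y z : V) (X : Set V) (F : Set (Sym2 V) → ℝ) :
    (prodBernoulli w).real ({ω : BondConfig V | ∀ x ∈ insert s X, ¬ (openGraph ω).Reachable y x} ∩
          {ω | ∀ x ∈ X, ¬ (openGraph ω).Reachable s x}) *
        ((prodBernoulli w).real {ω : BondConfig V | ∀ x ∈ X, ¬ (openGraph ω).Reachable s x} *
            (∫ ω in {ω : BondConfig V | ∀ x ∈ X, ¬ (openGraph ω).Reachable s x} ∩ openConn s z,
              F (openEdgeCluster ω s) ∂(prodBernoulli w)) -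
          (∫ ω in {ω : BondConfig V | ∀ x ∈ X, ¬ (openGraph ω).Reachable s x},
              F (openEdgeCluster ω s) ∂(prodBernoulli w)) *
            (prodBernoulli w).real ({ω : BondConfig V | ∀ x ∈ X, ¬ (openGraph ω).Reachable s x} ∩ openConn s z)) -
      (prodBernoulli w).real ({ω : BondConfig V | ∀ x ∈ insert s X, ¬ (openGraph ω).Reachable y x} ∩
          {ω | ∀ x ∈ X, ¬ (openGraph ω).Reachable s x} ∩ openConn y z) *
        ((prodBernoulli w).real {ω : BondConfig V | ∀ x ∈ X, ¬ (openGraph ω).Reachable s x} *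
            (∫ ω in {ω : BondConfig V | ∀ x ∈ X, ¬ (openGraph ω).Reachable s x} ∩ openConn s y,
              F (openEdgeCluster ω s) ∂(prodBernoulli w)) -
          (∫ ω in {ω : BondConfig V | ∀ x ∈ X, ¬ (openGraph ω).Reachable s x},
              F (openEdgeCluster ω s) ∂(prodBernoulli w)) *
            (prodBernoulli w).real ({ω : BondConfig V | ∀ x ∈ X, ¬ (openGraph ω).Reachable s x} ∩ openConn s y)) =
      ∑ η : Fin 3 → BondConfig V, (∏ c, weight (fun e => (w e : ℝ)) (η c)) *
        (ind ({ω : BondConfig V | ∀ x ∈ insert s X, ¬ (openGraph ω).Reachable y x} ∩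
              {ω | ∀ x ∈ X, ¬ (openGraph ω).Reachable s x}) (η 0) *
          ind {ω : BondConfig V | ∀ x ∈ X, ¬ (openGraph ω).Reachable s x} (η 1) *
          ind {ω : BondConfig V | ∀ x ∈ X, ¬ (openGraph ω).Reachable s x} (η 2) *
          (F (openEdgeCluster (η 2) s) - F (openEdgeCluster (η 1) s)) *
          (ind (openConn s z) (η 2) - ind (openConn y z) (η 0) * ind (openConn s y) (η 2))) := by
  classical
  set μ := prodBernoulli w with hμ
  set D : Set (BondConfig V) := {ω | ∀ x ∈ X, ¬ (openGraph ω).Reachable s x} with hD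
  set A : Set (BondConfig V) := {ω | ∀ x ∈ insert s X, ¬ (openGraph ω).Reachable y x} with hA
  set f : BondConfig V → ℝ := fun ω => F (openEdgeCluster ω s) with hf
  -- the eight quantities as weighted sums of indicator products
  have eAD : μ.real (A ∩ D) = ∑ ω, weight (fun e => (w e : ℝ)) ω * ind (A ∩ D) ω := by
    rw [hμ, measureReal_eq_sum]
  have eADW : μ.real (A ∩ D ∩ openConn y z) =
      ∑ ω, weight (fun e => (w e : ℝ)) ω * (ind (A ∩ D) ω * ind (openConn y z) ω) := by
    rw [hμ, measureReal_eq_sum]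
    refine Finset.sum_congr rfl fun ω _ => ?_
    rw [ind_inter]
  have eD : μ.real D = ∑ ω, weight (fun e => (w e : ℝ)) ω * ind D ω := by
    rw [hμ, measureReal_eq_sum]
  have eDZ : μ.real (D ∩ openConn s z) = ∑ ω, weight (fun e => (w e : ℝ)) ω * (ind D ω * ind (openConn s z) ω) := by
    rw [hμ, measureReal_eq_sum]
    refine Finset.sum_congr rfl fun ω _ => ?_
    rw [ind_inter]
  have eDY : μ.real (D ∩ openConn s y) = ∑ ω, weight (fun e => (w e : ℝ)) ω * (ind D ω * ind (openConn s y) ω) := by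
    rw [hμ, measureReal_eq_sum]
    refine Finset.sum_congr rfl fun ω _ => ?_
    rw [ind_inter]
  have iD : ∫ ω in D, f ω ∂μ = ∑ ω, weight (fun e => (w e : ℝ)) ω * (f ω * ind D ω) := by
    rw [hμ, setIntegral_eq_sum]
  have iDZ : ∫ ω in D ∩ openConn s z, f ω ∂μ =
      ∑ ω, weight (fun e => (w e : ℝ)) ω * (f ω * (ind D ω * ind (openConn s z) ω)) := by
    rw [hμ, setIntegral_eq_sum]
    refine Finset.sum_congr rfl fun ω _ => ?_
    rw [ind_inter]
  have iDY : ∫ ω in D ∩ openConn s y, f ω ∂μ =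
      ∑ ω, weight (fun e => (w e : ℝ)) ω * (f ω * (ind D ω * ind (openConn s y) ω)) := by
    rw [hμ, setIntegral_eq_sum]
    refine Finset.sum_congr rfl fun ω _ => ?_
    rw [ind_inter]
  change μ.real (A ∩ D) * (μ.real D * (∫ ω in D ∩ openConn s z, f ω ∂μ) - (∫ ω in D, f ω ∂μ) * μ.real (D ∩ openConn s z)) -
      μ.real (A ∩ D ∩ openConn y z) *
        (μ.real D * (∫ ω in D ∩ openConn s y, f ω ∂μ) - (∫ ω in D, f ω ∂μ) * μ.real (D ∩ openConn s y)) =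
      ∑ η : Fin 3 → BondConfig V, (∏ c, weight (fun e => (w e : ℝ)) (η c)) *
        (ind (A ∩ D) (η 0) * ind D (η 1) * ind D (η 2) * (f (η 2) - f (η 1)) *
          (ind (openConn s z) (η 2) - ind (openConn y z) (η 0) * ind (openConn s y) (η 2)))
  rw [eAD, eADW, eD, eDZ, eDY, iD, iDZ, iDY]
  exact mdlx_threeCopy_algebra w (ind (A ∩ D)) (ind (openConn y z)) (ind D) (ind (openConn s z)) (ind (openConn s y)) f

open LonePortSum BHK2006 DecisionTree in
/-- **REDUCTION: three-copy positivity implies MDL(X)′.**  Under `Consts.MDLXJointBernstein` the margin of `Consts.MDLXJoint` equals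
`Σ_k (∏_e w_e^{k_e}(1−w_e)^{3−k_e}) · B_F(k) ≥ 0` on every finite weighted graph (`Consts.mdlxJoint_margin_eq_sum_copies`,
`Consts.prod_atomWeight_eq_profile`), hence `Consts.MDLXJoint`. [cite: VandenbergHaggstromKahn2005, Thm. 1.1 (pp. 3–5)] -/
theorem mdlxJoint_of_bernstein (hB : MDLXJointBernstein) : MDLXJoint := by
  classical
  intro n w s y z X _hsy F hF
  rw [← sub_nonneg, mdlxJoint_margin_eq_sum_copies]
  -- abbreviate the integrand (indicator form)
  set Φ : (Fin 3 → BondConfig (Fin n)) → ℝ := fun η =>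
    ind ({ω : BondConfig (Fin n) | ∀ x ∈ insert s X, ¬ (openGraph ω).Reachable y x} ∩
          {ω | ∀ x ∈ X, ¬ (openGraph ω).Reachable s x}) (η 0) *
      ind {ω : BondConfig (Fin n) | ∀ x ∈ X, ¬ (openGraph ω).Reachable s x} (η 1) *
      ind {ω : BondConfig (Fin n) | ∀ x ∈ X, ¬ (openGraph ω).Reachable s x} (η 2) *
      (F (openEdgeCluster (η 2) s) - F (openEdgeCluster (η 1) s)) *
      (ind (openConn s z) (η 2) - ind (openConn y z) (η 0) * ind (openConn s y) (η 2)) with hΦ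
  -- the weight of a triple is the Bernstein monomial of its profile
  have hwt : ∀ η : Fin 3 → BondConfig (Fin n), (∏ c, weight (fun e => (w e : ℝ)) (η c)) =
      ∏ e, ((w e : unitInterval) : ℝ) ^ (∑ c : Fin 3, if e ∈ η c then (1 : ℕ) else 0) *
        (1 - ((w e : unitInterval) : ℝ)) ^ (3 - ∑ c : Fin 3, if e ∈ η c then (1 : ℕ) else 0) := by
    intro η
    rw [← prod_atomWeight_eq_profile]
    rfl
  simp_rw [hwt]
  -- the fibre sums are the conjecture's signed sums
  have hfib : ∀ k : Sym2 (Fin n) → ℕ, 0 ≤ ∑ η ∈ (Finset.univ : Finset (Fin 3 → BondConfig (Fin n))).filter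
      (fun η => (fun e => ∑ c : Fin 3, if e ∈ η c then (1 : ℕ) else 0) = k), Φ η := by
    intro k
    have hBk := hB n s y z X k F hF
    refine le_of_le_of_eq hBk (Finset.sum_congr rfl fun η _ => ?_)
    simp only [hΦ, ind, openConn, Set.mem_inter_iff, Set.mem_setOf_eq]
    congr!
  have hmain : 0 ≤ ∑ k ∈ (Finset.univ : Finset (Fin 3 → BondConfig (Fin n))).image
        (fun η : Fin 3 → BondConfig (Fin n) => fun e : Sym2 (Fin n) => ∑ c : Fin 3, if e ∈ η c then (1 : ℕ) else 0),
      ∑ η ∈ (Finset.univ : Finset (Fin 3 → BondConfig (Fin n))).filter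
          (fun η => (fun e => ∑ c : Fin 3, if e ∈ η c then (1 : ℕ) else 0) = k),
        (∏ e, ((w e : unitInterval) : ℝ) ^ (∑ c : Fin 3, if e ∈ η c then (1 : ℕ) else 0) *
            (1 - ((w e : unitInterval) : ℝ)) ^ (3 - ∑ c : Fin 3, if e ∈ η c then (1 : ℕ) else 0)) * Φ η := by
    refine Finset.sum_nonneg fun k _ => ?_
    have hcongr : ∀ η ∈ (Finset.univ : Finset (Fin 3 → BondConfig (Fin n))).filter
          (fun η => (fun e => ∑ c : Fin 3, if e ∈ η c then (1 : ℕ) else 0) = k),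
        (∏ e, ((w e : unitInterval) : ℝ) ^ (∑ c : Fin 3, if e ∈ η c then (1 : ℕ) else 0) *
            (1 - ((w e : unitInterval) : ℝ)) ^ (3 - ∑ c : Fin 3, if e ∈ η c then (1 : ℕ) else 0)) * Φ η =
        (∏ e, ((w e : unitInterval) : ℝ) ^ (k e) * (1 - ((w e : unitInterval) : ℝ)) ^ (3 - k e)) * Φ η := by
      intro η hη
      have hk : ∀ e, (∑ c : Fin 3, if e ∈ η c then (1 : ℕ) else 0) = k e :=
        fun e => congrFun (Finset.mem_filter.1 hη).2 e
      simp_rw [hk]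
    rw [Finset.sum_congr rfl hcongr, ← Finset.mul_sum]
    exact mul_nonneg (Finset.prod_nonneg fun e _ =>
      mul_nonneg (pow_nonneg (w e).2.1 _) (pow_nonneg (sub_nonneg.2 (w e).2.2) _)) (hfib k)
  have hsplit := Finset.sum_fiberwise_of_maps_to
    (s := (Finset.univ : Finset (Fin 3 → BondConfig (Fin n))))
    (t := (Finset.univ : Finset (Fin 3 → BondConfig (Fin n))).image
      (fun η : Fin 3 → BondConfig (Fin n) => fun e : Sym2 (Fin n) => ∑ c : Fin 3, if e ∈ η c then (1 : ℕ) else 0))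
    (g := fun η : Fin 3 → BondConfig (Fin n) => fun e : Sym2 (Fin n) => ∑ c : Fin 3, if e ∈ η c then (1 : ℕ) else 0)
    (fun η hη => Finset.mem_image_of_mem _ hη)
    (fun η : Fin 3 → BondConfig (Fin n) =>
      (∏ e, ((w e : unitInterval) : ℝ) ^ (∑ c : Fin 3, if e ∈ η c then (1 : ℕ) else 0) *
          (1 - ((w e : unitInterval) : ℝ)) ^ (3 - ∑ c : Fin 3, if e ∈ η c then (1 : ℕ) else 0)) * Φ η)
  have h2 : (0 : ℝ) ≤ ∑ η : Fin 3 → BondConfig (Fin n),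
      (∏ e, ((w e : unitInterval) : ℝ) ^ (∑ c : Fin 3, if e ∈ η c then (1 : ℕ) else 0) *
          (1 - ((w e : unitInterval) : ℝ)) ^ (3 - ∑ c : Fin 3, if e ∈ η c then (1 : ℕ) else 0)) * Φ η := by
    rw [← hsplit]
    exact hmain
  simpa only [hΦ] using h2


end Consts

end Summit.CriticalPhenomena.PercolationContinuityZ3.Theorems

end
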